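import Mathlib
import Summits.Ventures.FusionMHD.Models.CerfonFreidbergIterLikeQHalfGradBoxes1
import Summits.Ventures.FusionMHD.Models.CerfonFreidbergIterLikeQHalfGradBoxes2
import Summits.Ventures.FusionMHD.Models.CerfonFreidbergIterLikeQHalfMercEnvelope
import Summits.Ventures.FusionMHD.Models.CerfonFreidbergIterLikeQHalfMercSound
import Summits.Ventures.FusionMHD.Models.FluxSurfacePolarRayLevelGGJMercier
import HarnessLib

/-!
# Ventures/FusionMHD — Models/CerfonFreidbergIterLikeQHalfMercLink.lean: the four F-independent Mercier KERNELS on `(θ, s)`, their algebraic and register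
# forms, the 32 per-panel `∂_s G` boxes, the per-panel link data `MercLink` with its rational side conditions, and the GENERIC TUBE LINK `tube_link`

HONEST FRAMING (LADDER-GRIDFUSION three columns; CF rung, F2 item R2; «F2.R2-CF-MERCIER-IMPLICIT» step (4) of `pub/gridfusion/models/F2-SCOPING.md` v1.6 §10(c)).
* §1 the kernels `KW = volKernelDs/D`, `KS = invGradKernel` (`R s/(DG)`), `KR = R²·volKernel/G` (`R³s/(DG)`), `KB = volKernel/(R²G)` (`s/(RDG)`) of THE flux's fields
  (`Dfield`, `F2field`, `Gfield`); their factorised forms where `R, D, G ≠ 0` (`KW_eq`, …) and their identification with model-7's register functions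
  `gWA, gAsA, gARA, gB1A` (`…QHalfMercSound`) along the approximant where `X, D, G ≠ 0` (`gWA_eq`, …);
* §2 `gsokP`: the THIRTY-TWO per-panel `∂_s G` boxes `gBox k` with bounds `MGP k` (`…QHalfGradBoxes`, decided in `…QHalfGradBoxes1–2`) all pass;
* §3 `MercLink` (per panel: box index `g` of `f3Box`, the four envelope constants `EW, ES, ER, EB` and the four brackets) and `MercLink.check` (rational side
  conditions against ★ #117's `PanelCert/BoxData/LinkData` and model-7's `MercCert`);
* §4 **`tube_link`**: a `LevelPanel` + `StripFacts` + a certified segment `FSegOK g …` of a function that agrees with `K(θ, mθ)·π` on the `t`-panel + a tube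
  envelope `E` ⇒ `Lo ≤ ∫_{Θ_j} K(θ, ρ θ) dθ ≤ Hi` (my `LevelPanel.kernel_integral_tube`), with integrability — the common tail of every register link.
CERTIFIED: kernel (this file + imports, axioms standard).  VALIDATED: nothing used.  MODELLED: analytic Cerfon–Freidberg family; kernels of a MODEL flux —
nothing about a device or stability.  Typer/prover: gridfusion-model-7 (g7), 2026-08-27.
Citations: Jardin 2010 §8.5 (8.134) [Jardin2010]; Freidberg 2014 §6.6.1 (6.153) [Freidberg2014]; Moore 1979 §4.3 (4.21) [Moore1979].
-/

noncomputable section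

open Set MeasureTheory intervalIntegral Filter Topology NonemptyInterval
open Literature.Analysis.ODE Literature.Analysis.ODE.FExpr
open Literature.Analysis.ValidatedNumerics Literature.Analysis.ValidatedNumerics.PolyMP
open Literature.Analysis.ValidatedNumerics.NumericsMP Literature.Analysis.ValidatedNumerics.ExpPoly
open Literature.Analysis.ValidatedNumerics.ITaylor
open Literature.MathematicalPhysics.MHD Literature.MathematicalPhysics.MHD.CerfonFreidberg
open Summit.Ventures.FusionMHD.Models.PolarRay
open Summit.Ventures.FusionMHD.Models.CFIterLike.PolarPanel

set_option autoImplicit false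

namespace Summit.Ventures.FusionMHD.Models.CFIterLike.QHalf

/-! ## §1 The four kernels -/

/-- The `V″`-kernel `volKernelDs/D` of THE flux. -/
def KW (θ s : ℝ) : ℝ := volKernelDs Xa Dfield F2field θ s / Dfield θ s
/-- The `⟨1/|∇ψ|²⟩`-kernel `invGradKernel = volKernel/G = R s/(D G)`. -/
def KS (θ s : ℝ) : ℝ := invGradKernel Xa Dfield Gfield θ s
/-- The kernel `R²·volKernel/G = R³ s/(D G)` (`= g²·sigmaSqKernel + invBsqKernel`, F-independent). -/
def KR (θ s : ℝ) : ℝ := (Xa + s * Real.cos θ) ^ 2 * volKernel Xa Dfield θ s / Gfield θ s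
/-- The kernel `volKernel/(R²·G) = s/(R D G)` (the `g²`-coefficient of `bsqGradKernel`). -/
def KB (θ s : ℝ) : ℝ := volKernel Xa Dfield θ s / ((Xa + s * Real.cos θ) ^ 2 * Gfield θ s)

section forms
variable {θ s : ℝ}

/-- Factorised form of `KW`. -/
theorem KW_eq (hD : Dfield θ s ≠ 0) :
    KW θ s = (Xa + 2 * s * Real.cos θ) * (1 / Dfield θ s ^ 2) - ((Xa + s * Real.cos θ) * s) * F2field θ s * (1 / Dfield θ s ^ 3) := by
  unfold KW volKernelDs; field_simp
/-- Factorised form of `KS`. -/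
theorem KS_eq (hD : Dfield θ s ≠ 0) (hG : Gfield θ s ≠ 0) :
    KS θ s = ((Xa + s * Real.cos θ) * s) * (1 / Dfield θ s) * (1 / Gfield θ s) := by
  unfold KS invGradKernel volKernel; field_simp
/-- Factorised form of `KR`. -/
theorem KR_eq (hD : Dfield θ s ≠ 0) (hG : Gfield θ s ≠ 0) :
    KR θ s = ((Xa + s * Real.cos θ) ^ 3 * s) * (1 / Dfield θ s) * (1 / Gfield θ s) := by
  unfold KR volKernel; field_simp
/-- Factorised form of `KB`. -/
theorem KB_eq (hR : Xa + s * Real.cos θ ≠ 0) (hD : Dfield θ s ≠ 0) (hG : Gfield θ s ≠ 0) :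
    KB θ s = (s * (1 / (Xa + s * Real.cos θ))) * (1 / Dfield θ s) * (1 / Gfield θ s) := by
  unfold KB volKernel; field_simp

end forms

section regs
variable {t : ℝ}

/-- The register function `gWA` IS `KW(πt, mA t)·π` where `X, D ≠ 0`. -/
theorem gWA_eq (hX : QHalfMerc.XA t ≠ 0) (hD : DrA t ≠ 0) : QHalfMerc.gWA t = KW (Real.pi * t) (mA t) * Real.pi := by
  have hD' : Dfield (Real.pi * t) (mA t) ≠ 0 := hD
  have hX' : Xa + mA t * Real.cos (Real.pi * t) ≠ 0 := hX
  unfold QHalfMerc.gWA QHalfMerc.XA QHalfMerc.F2A KW volKernelDs DrA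
  unfold Dfield at hD' ⊢
  field_simp
  ring
/-- `gAsA = KS(πt, mA t)·π` where `X, D, G ≠ 0`. -/
theorem gAsA_eq (hX : QHalfMerc.XA t ≠ 0) (hD : DrA t ≠ 0) (hG : QHalfMerc.GA t ≠ 0) : QHalfMerc.gAsA t = KS (Real.pi * t) (mA t) * Real.pi := by
  have hD' : Dfield (Real.pi * t) (mA t) ≠ 0 := hD
  have hX' : Xa + mA t * Real.cos (Real.pi * t) ≠ 0 := hX
  have hG' : Gfield (Real.pi * t) (mA t) ≠ 0 := hG
  unfold QHalfMerc.gAsA QHalfMerc.XA QHalfMerc.GA KS invGradKernel volKernel DrA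
  unfold Dfield at hD' ⊢
  field_simp
/-- `gARA = KR(πt, mA t)·π` where `X, D, G ≠ 0`. -/
theorem gARA_eq (hX : QHalfMerc.XA t ≠ 0) (hD : DrA t ≠ 0) (hG : QHalfMerc.GA t ≠ 0) : QHalfMerc.gARA t = KR (Real.pi * t) (mA t) * Real.pi := by
  have hD' : Dfield (Real.pi * t) (mA t) ≠ 0 := hD
  have hX' : Xa + mA t * Real.cos (Real.pi * t) ≠ 0 := hX
  have hG' : Gfield (Real.pi * t) (mA t) ≠ 0 := hG
  unfold QHalfMerc.gARA QHalfMerc.XA QHalfMerc.GA KR volKernel DrA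
  unfold Dfield at hD' ⊢
  field_simp
/-- `gB1A = KB(πt, mA t)·π` where `X, D, G ≠ 0`. -/
theorem gB1A_eq (hX : QHalfMerc.XA t ≠ 0) (hD : DrA t ≠ 0) (hG : QHalfMerc.GA t ≠ 0) : QHalfMerc.gB1A t = KB (Real.pi * t) (mA t) * Real.pi := by
  have hD' : Dfield (Real.pi * t) (mA t) ≠ 0 := hD
  have hX' : Xa + mA t * Real.cos (Real.pi * t) ≠ 0 := hX
  have hG' : Gfield (Real.pi * t) (mA t) ≠ 0 := hG
  unfold QHalfMerc.gB1A QHalfMerc.XA QHalfMerc.GA KB volKernel DrA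
  unfold Dfield at hD' ⊢
  field_simp

end regs

/-! ## §2 Every panel's `∂_s G` box passes (the 32 `decide`s of `…QHalfGradBoxes1–2`) -/

/-- Every panel's box passes. -/
theorem gsokP {k : ℕ} (hk : k < 32) : gsok1 k = true := by
  interval_cases k
  exacts [gsok1_0, gsok1_1, gsok1_2, gsok1_3, gsok1_4, gsok1_5, gsok1_6, gsok1_7, gsok1_8, gsok1_9, gsok1_10, gsok1_11, gsok1_12, gsok1_13,
    gsok1_14, gsok1_15, gsok1_16, gsok1_17, gsok1_18, gsok1_19, gsok1_20, gsok1_21, gsok1_22, gsok1_23, gsok1_24, gsok1_25, gsok1_26, gsok1_27,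
    gsok1_28, gsok1_29, gsok1_30, gsok1_31]

/-! ## §3 Per-panel Mercier-link data and its rational side conditions -/

/-- Per-panel Mercier-link constants: panel `j`, third-derivative box `g`, envelopes `EW ES ER EB`, brackets of the four panel integrals. -/
structure MercLink where
  /-- panel index -/
  j : ℕ
  /-- index of the `f3Box` containing the tube -/
  g : ℕ
  /-- envelope of `KW` -/
  EW : ℚ
  /-- envelope of `KS` -/
  ES : ℚ
  /-- envelope of `KR` -/
  ER : ℚ
  /-- envelope of `KB` -/
  EB : ℚ
  /-- bracket of `∫ KW` -/
  WLo : ℚ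
  /-- … -/
  WHi : ℚ
  /-- bracket of `∫ KS` -/
  SLo : ℚ
  /-- … -/
  SHi : ℚ
  /-- bracket of `∫ KR` -/
  RLo : ℚ
  /-- … -/
  RHi : ℚ
  /-- bracket of `∫ KB` -/
  BLo : ℚ
  /-- … -/
  BHi : ℚ

/-- THE RATIONAL SIDE CONDITIONS of the Mercier link on panel `j`. -/
def MercLink.check (ml : MercLink) (ℓ : LinkData) (d : PanelCert) (b : BoxData) (mc : QHalfMerc.MercCert) : Bool :=
  let B := f3Box ml.g
  let C := gBox d.j
  let μ : ℚ := (d.dlo : ℚ) / tmS - b.M * ℓ.r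
  let ν : ℚ := (d.dhi : ℚ) / tmS + b.M * ℓ.r
  let Xlo : ℚ := XaLoQ - b.smax
  let Xhi : ℚ := XaHiQ + b.smax
  decide (mc.j = d.j) && decide (ml.j = d.j) && decide (ml.g < 8) && decide (d.j < 32)
  && decide (B.1 ≤ piLoQ * panelLeft hw d.j) && decide (piHiQ * panelLeft hw (d.j + 1) ≤ B.2.1)
  && decide (0 ≤ B.2.2.1) && decide (B.2.2.2 < 1)
  && decide (B.2.2.1 ≤ (d.mlo : ℚ) / tmS - ℓ.r) && decide ((d.mhi : ℚ) / tmS + ℓ.r ≤ B.2.2.2)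
  && decide (C.1 ≤ piLoQ * panelLeft hw d.j) && decide (piHiQ * panelLeft hw (d.j + 1) ≤ C.2.1)
  && decide (0 < C.2.2.1) && decide (C.2.2.2 < 1)
  && decide (C.2.2.1 ≤ (d.mlo : ℚ) / tmS - ℓ.r) && decide ((d.mhi : ℚ) / tmS + ℓ.r ≤ C.2.2.2)
  && decide (0 < μ) && decide (0 < Xlo) && decide (0 ≤ ml.EW) && decide (0 ≤ ml.ES) && decide (0 ≤ ml.ER) && decide (0 ≤ ml.EB)
  && decide (envW XaHiQ ℓ.r b.M M3Q μ ν Xhi b.smax ≤ ml.EW) && decide (envS ℓ.r b.M (MGP d.j) μ Xhi b.smax ≤ ml.ES)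
  && decide (envR ℓ.r b.M (MGP d.j) μ Xhi b.smax ≤ ml.ER) && decide (envB ℓ.r b.M (MGP d.j) μ Xlo b.smax ≤ ml.EB)
  && decide (ml.WLo ≤ (mc.wlo : ℚ) / tmS - ml.EW * (piHiQ / 32)) && decide ((mc.whi : ℚ) / tmS + ml.EW * (piHiQ / 32) ≤ ml.WHi)
  && decide (ml.SLo ≤ (mc.slo : ℚ) / tmS - ml.ES * (piHiQ / 32)) && decide ((mc.shi : ℚ) / tmS + ml.ES * (piHiQ / 32) ≤ ml.SHi)
  && decide (ml.RLo ≤ (mc.rlo : ℚ) / tmS - ml.ER * (piHiQ / 32)) && decide ((mc.rhi : ℚ) / tmS + ml.ER * (piHiQ / 32) ≤ ml.RHi)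
  && decide (ml.BLo ≤ (mc.blo : ℚ) / tmS - ml.EB * (piHiQ / 32)) && decide ((mc.bhi : ℚ) / tmS + ml.EB * (piHiQ / 32) ≤ ml.BHi)

/-! ## §4 The generic tube link -/

section link

variable {a a' sA smax r M η mlo mhi dlo dhi : ℝ}

set_option maxHeartbeats 1600000 in
/-- **GENERIC TUBE LINK.**  A `LevelPanel` with the strip facts on `Θ = [π·2jh, π·(2j+2)h]`; a kernel `K` jointly continuous on the box; a certified segment of a
function `g` which equals `K(πt, mθ(πt))·π` on the `t`-panel; a tube envelope `E ≥ 0` ⇒ the bracket `[plo·2⁻⁶⁰ − Eπ⁺/32, phi·2⁻⁶⁰ + Eπ⁺/32] ⊂ [Lo, Hi]`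
contains `∫_Θ K(θ, ρ θ) dθ`, and the integrand is interval integrable. -/
theorem tube_link {j : ℕ} (P : LevelPanel U Xa 0 a a' sA smax (u₀ - ((δQ : ℚ) : ℝ)) (u₀ + ((δQ : ℚ) : ℝ)) Dfield)
    (SF : StripFacts a a' sA smax r M η mlo mhi dlo dhi)
    (ha : a = Real.pi * ((panelLeft hw j : ℚ) : ℝ)) (ha' : a' = Real.pi * ((panelLeft hw (j + 1) : ℚ) : ℝ))
    {K : ℝ → ℝ → ℝ} (hKc : ContinuousOn (fun p : ℝ × ℝ => K p.1 p.2) (Icc a a' ×ˢ Icc sA smax))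
    {g : ℝ → ℝ} {plo phi : ℤ} (hseg : FSegOK g [1] tmS (panelLeft hw j) (panelLeft hw (j + 1)) plo phi)
    (hg : ∀ t ∈ Icc ((panelLeft hw j : ℚ) : ℝ) ((panelLeft hw (j + 1) : ℚ) : ℝ), g t = K (Real.pi * t) (mθ (Real.pi * t)) * Real.pi)
    {E : ℝ} (hE0 : 0 ≤ E) (hE : ∀ θ ∈ Icc a a', ∀ s ∈ Icc (mθ θ - r) (mθ θ + r), |K θ s - K θ (mθ θ)| ≤ E)
    {Lo Hi : ℝ} (hLo : Lo ≤ (plo : ℝ) / ((tmS : ℕ) : ℝ) - E * (((piHiQ : ℚ) : ℝ) / 32))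
    (hHi : (phi : ℝ) / ((tmS : ℕ) : ℝ) + E * (((piHiQ : ℚ) : ℝ) / 32) ≤ Hi) :
    Lo ≤ ∫ θ in a..a', K θ (ρ θ) ∧ ∫ θ in a..a', K θ (ρ θ) ≤ Hi ∧ IntervalIntegrable (fun θ => K θ (ρ θ)) volume a a' := by
  have hS : (0 : ℝ) < ((tmS : ℕ) : ℝ) := by exact_mod_cast tmS_pos
  have hpi := Real.pi_pos
  have hpiHi : Real.pi < ((piHiQ : ℚ) : ℝ) := by have := Real.pi_lt_d20; norm_num [piHiQ] at this ⊢; exact this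
  have hwidth : a' - a = Real.pi / 32 := by rw [ha, ha']; simp only [panelLeft, hw]; push_cast; ring
  set t0 : ℝ := ((panelLeft hw j : ℚ) : ℝ) with ht0
  set t1 : ℝ := ((panelLeft hw (j + 1) : ℚ) : ℝ) with ht1
  have ht01 : t0 ≤ t1 := by rw [ht0, ht1]; exact_mod_cast (show panelLeft hw j ≤ panelLeft hw (j + 1) by unfold panelLeft hw; push_cast; nlinarith)
  -- the segment
  obtain ⟨hseg1, hseg2, hsegI⟩ := hseg
  have hev1 : ∀ t : ℝ, Poly.eval [1] t = 1 := by intro t; simp [Poly.eval_cons, Poly.eval_nil]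
  simp only [hev1, mul_one] at hseg1 hseg2 hsegI
  set Φm : ℝ → ℝ := fun θ => K θ (mθ θ) with hΦm
  set gm : ℝ → ℝ := fun t => Φm (Real.pi * t) * Real.pi with hgm
  have hg' : ∀ t ∈ uIcc t0 t1, g t = gm t := by
    intro t ht; rw [uIcc_of_le ht01] at ht; exact hg t ht
  have hIg : ∫ t in t0..t1, g t = ∫ t in t0..t1, gm t := intervalIntegral.integral_congr hg'
  have hJ : ∫ t in t0..t1, gm t = ∫ θ in a..a', Φm θ := by
    rw [hgm, intervalIntegral.integral_mul_const, mul_comm, ← smul_eq_mul, intervalIntegral.smul_integral_comp_mul_left, ha, ha']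
  have hJlo : (plo : ℝ) / ((tmS : ℕ) : ℝ) ≤ ∫ θ in a..a', Φm θ := by
    rw [← hJ, ← hIg, div_le_iff₀ hS, mul_comm]; exact hseg1
  have hJhi : ∫ θ in a..a', Φm θ ≤ (phi : ℝ) / ((tmS : ℕ) : ℝ) := by
    rw [← hJ, ← hIg, le_div_iff₀ hS, mul_comm]; exact hseg2
  -- integrability of Φm on [a, a']
  have hsegI' : IntervalIntegrable gm volume t0 t1 := by
    refine hsegI.congr ?_
    intro t ht
    exact hg' t (uIoc_subset_uIcc ht)
  have hmid : IntervalIntegrable Φm volume a a' := by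
    have h1 : IntervalIntegrable (fun x => gm (Real.pi⁻¹ * x)) volume (t0 / Real.pi⁻¹) (t1 / Real.pi⁻¹) :=
      hsegI'.comp_mul_left (h := enorm_ne_top) (h' := enorm_ne_top)
    have e1 : t0 / Real.pi⁻¹ = a := by rw [div_inv_eq_mul, mul_comm, ha]
    have e2 : t1 / Real.pi⁻¹ = a' := by rw [div_inv_eq_mul, mul_comm, ha']
    rw [e1, e2] at h1
    have h2 := h1.div_const Real.pi
    have hfun : (fun x => gm (Real.pi⁻¹ * x) / Real.pi) = Φm := by
      funext x
      rw [hgm]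
      show Φm (Real.pi * (Real.pi⁻¹ * x)) * Real.pi / Real.pi = Φm x
      rw [mul_inv_cancel_left₀ hpi.ne' x, mul_div_cancel_right₀ _ hpi.ne']
    rw [hfun] at h2
    exact h2
  -- the tube link
  have hT := P.kernel_integral_tube u₀_mem hKc (m := mθ) (r := r) (η := η) (μ := dlo - M * r) (E := E) SF.hr SF.hημ
    (fun θ hθ => SF.tube_ends hθ) SF.res (fun θ hθ s hs => (SF.tube_D hθ hs).2.1) hE hmid
  rw [hwidth] at hT
  obtain ⟨hT1, hT2⟩ := hT
  have hEw : E * (Real.pi / 32) ≤ E * (((piHiQ : ℚ) : ℝ) / 32) := mul_le_mul_of_nonneg_left (by linarith) hE0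
  refine ⟨?_, ?_, P.intervalIntegrable_kernel hKc u₀_mem⟩
  · change _ ≤ ∫ θ in a..a', K θ (rayRadius U Xa 0 u₀ θ)
    linarith
  · change ∫ θ in a..a', K θ (rayRadius U Xa 0 u₀ θ) ≤ _
    linarith

end link

end Summit.Ventures.FusionMHD.Models.CFIterLike.QHalf

end
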